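import Mathlib
import Summits.MatrixMultiplication.MatrixMultiplication.Theorems.FieldSumsetRankTwoByTwoHostingEightPairs
import Summits.MatrixMultiplication.MatrixMultiplication.Theorems.FieldSumsetRankTwoByTwoHostingEightPlanes

/-!
# No `2 × 2` matrix multiplication inside `4 × 4 → 7` polynomial multiplication

Route FieldSumsetRank, item stmt-MatrixMultiplication-8741 (`TwoByTwoHostingEight`), the rigidity
step ("Lemma A" of the card, in an elementary form). Let `L ⊇ ℂ` be a field, `a ∈ L ∖ ℂ`, and
`A, B : M₂(ℂ) → L` injective linear maps onto / into the progression `⟨1, a, a², a³⟩`. Then the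
products `A(X) B(Y)` over the pairs with `XY = 0` span a space of dimension `≥ 4`.

Proof. For `ξ_j = (1, j)` (`j < 8`) put `F_j = A(ℂ² ξ_jᵀ)`, `G_j = B(ξ_j^⊥ ℂ²ᵀ)`; these are
planes with `F_j G_j ⊆ K` (the span in question), the `F_j` pairwise complementary in
`⟨1, a, a², a³⟩ ∋ 1`. If `dim K ≤ 3`, the plane lemma makes every `(F_j, G_j)` a pair of dilates
of a progression `⟨1, b_j⟩` and `K = c_j ⟨1, b_j, b_j²⟩`, whence `dim(K F_j) = 4` and
Bachoc–Serra–Zémor's Lemma 5 gives `F_j = h_j ⟨1, b⟩` for the single ratio `b = b_0`. Writing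
`b = l₁(a)/l₀(a)` in lowest terms, `F_j = φ_j(a) · ⟨l₀(a), l₁(a)⟩` with polynomials `φ_j` all
dividing a fixed non-zero `k` of degree `≤ 6` (`K = F_j G_j ⊆ ⟨1, …, a⁶⟩`); complementarity makes
at most one `φ_j` constant and the roots of the others pairwise distinct roots of `k`: `7 > 6`.
-/

set_option linter.dupNamespace false

noncomputable section

open Module Polynomial

namespace Summit.MatrixMultiplication.MatrixMultiplication.Theorems

namespace TwoByTwoHosting

open Literature.Combinatorics.Additive.BachocSerraZemor

variable {L : Type} [Field L] [Algebra ℂ L]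

set_option maxHeartbeats 400000 in
/-- **Rigidity** ("Lemma A"): `2 × 2` matrix multiplication does not factor through the
multiplication `⟨1,a,a²,a³⟩ × ⟨1,a,a²,a³⟩ → ⟨1,…,a⁶⟩` with injective input maps: the products
`A(X) B(Y)`, `XY = 0`, cannot all lie in a space of dimension `≤ 3`. -/
theorem rigidity {a : L} (ha : ∀ c : ℂ, algebraMap ℂ L c ≠ a)
    (A B : Matrix (Fin 2) (Fin 2) ℂ →ₗ[ℂ] L) (hA : Function.Injective A)
    (hB : Function.Injective B)
    (hAr : LinearMap.range A = Submodule.span ℂ (Set.range fun i : Fin 4 => a ^ (i : ℕ)))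
    (hBr : LinearMap.range B ≤ Submodule.span ℂ (Set.range fun i : Fin 4 => a ^ (i : ℕ)))
    (K : Submodule ℂ L) [FiniteDimensional ℂ K] (hK3 : finrank ℂ K ≤ 3)
    (hK : ∀ X Y : Matrix (Fin 2) (Fin 2) ℂ, X * Y = 0 → A X * B Y ∈ K) : False := by
  have hatr : Transcendental ℂ a := transcendental_of_forall_ne ha
  have hι : Function.Injective (aeval (R := ℂ) a) := transcendental_iff_injective.mp hatr
  obtain ⟨row, hrow⟩ := exists_rowMap
  obtain ⟨col, hcol⟩ := exists_colMap
  -- the families of planes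
  obtain ⟨F, hF_def⟩ : ∃ F : Fin 8 → Submodule ℂ L,
      ∀ j, F j = LinearMap.range (A ∘ₗ row ![1, (j : ℂ)]) := ⟨_, fun j => rfl⟩
  obtain ⟨G, hG_def⟩ : ∃ G : Fin 8 → Submodule ℂ L,
      ∀ j, G j = LinearMap.range (B ∘ₗ col ![(j : ℂ), -1]) := ⟨_, fun j => rfl⟩
  have hFG : ∀ j, F j * G j ≤ K := fun j => by
    rw [Submodule.mul_le, hF_def, hG_def]
    rintro _ ⟨x, rfl⟩ _ ⟨η, rfl⟩
    exact hK _ _ (rowMap_mul_colMap row col hrow hcol j x η)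
  have hF2 : ∀ j, finrank ℂ (F j) = 2 := fun j => by
    have hinj : Function.Injective (A ∘ₗ row ![1, (j : ℂ)]) := fun x y hxy =>
      rowMap_injective row hrow j (hA hxy)
    rw [hF_def, LinearMap.finrank_range_of_inj hinj, Module.finrank_fin_fun]
  have hG2 : ∀ j, finrank ℂ (G j) = 2 := fun j => by
    have hinj : Function.Injective (B ∘ₗ col ![(j : ℂ), -1]) := fun x y hxy =>
      colMap_injective col hcol j (hB hxy)
    rw [hG_def, LinearMap.finrank_range_of_inj hinj, Module.finrank_fin_fun]
  have hFmap : ∀ j, F j = (LinearMap.range (row ![1, (j : ℂ)])).map A := fun j => by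
    rw [hF_def, LinearMap.range_comp]
  have hFle : ∀ j, F j ≤ Submodule.span ℂ (Set.range fun i : Fin 4 => a ^ (i : ℕ)) :=
    fun j => by
    rw [← hAr, hFmap]
    exact LinearMap.map_le_range
  have hGle : ∀ j, G j ≤ Submodule.span ℂ (Set.range fun i : Fin 4 => a ^ (i : ℕ)) :=
    fun j => by
    refine le_trans ?_ hBr
    rw [hG_def, LinearMap.range_comp]
    exact LinearMap.map_le_range
  have hFinf : ∀ j j', j ≠ j' → F j ⊓ F j' = ⊥ := fun j j' hjj' => by
    rw [hFmap, hFmap, ← Submodule.map_inf A hA, range_rowMap_inf row hrow j j' hjj',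
      Submodule.map_bot]
  have hFsup : ∀ j j', j ≠ j' →
      F j ⊔ F j' = Submodule.span ℂ (Set.range fun i : Fin 4 => a ^ (i : ℕ)) :=
    fun j j' hjj' => by
    rw [hFmap, hFmap, ← Submodule.map_sup, range_rowMap_sup row hrow j j' hjj',
      Submodule.map_top, hAr]
  haveI : ∀ j, FiniteDimensional ℂ (F j) := fun j => by rw [hF_def]; infer_instance
  haveI : ∀ j, FiniteDimensional ℂ (G j) := fun j => by rw [hG_def]; infer_instance
  haveI : ∀ j, FiniteDimensional ℂ ↥(F j * G j) := fun j => finiteDimensional_mul _ _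
  -- per-`j` structure from the plane lemma
  have hstruct : ∀ j, ∃ f g b : L, f ≠ 0 ∧ g ≠ 0 ∧ (∀ c : ℂ, algebraMap ℂ L c ≠ b) ∧
      F j = (Submodule.span ℂ (Set.range fun i : Fin 2 => b ^ (i : ℕ))).map
        (LinearMap.mulLeft ℂ f) ∧
      G j = (Submodule.span ℂ (Set.range fun i : Fin 2 => b ^ (i : ℕ))).map
        (LinearMap.mulLeft ℂ g) := fun j =>
    pair_structure (F j) (G j) (hF2 j) (hG2 j) ((Submodule.finrank_mono (hFG j)).trans hK3)
  choose f g b hf hg hb hFj hGj using hstruct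
  have hFGj : ∀ j, F j * G j =
      (Submodule.span ℂ (Set.range fun i : Fin 3 => b j ^ (i : ℕ))).map
        (LinearMap.mulLeft ℂ (f j * g j)) := fun j => by
    rw [hFj j, hGj j, dil_mul_dil, prog_mul_prog (b j) 1 1]
  have hKj : ∀ j, K = (Submodule.span ℂ (Set.range fun i : Fin 3 => b j ^ (i : ℕ))).map
      (LinearMap.mulLeft ℂ (f j * g j)) := fun j => by
    have h3 : finrank ℂ ↥(F j * G j) = 3 := by
      rw [hFGj j, finrank_dil (mul_ne_zero (hf j) (hg j)), finrank_prog (hb j)]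
    rw [← hFGj j]
    exact (Submodule.eq_of_le_of_finrank_eq (hFG j)
      (le_antisymm (Submodule.finrank_mono (hFG j)) (hK3.trans h3.symm.le))).symm
  have hKfin : finrank ℂ K = 3 := by
    rw [hKj 0, finrank_dil (mul_ne_zero (hf 0) (hg 0)), finrank_prog (hb 0)]
  have hKF : ∀ j, finrank ℂ ↥(K * F j) = 4 := fun j => by
    rw [hKj j, hFj j, dil_mul_dil, prog_mul_prog (b j) 2 1,
      finrank_dil (mul_ne_zero (mul_ne_zero (hf j) (hg j)) (hf j)), finrank_prog (hb j)]
  -- Lemma 5: all `F j` are dilates of `⟨1, b 0⟩`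
  set b₀ : L := b 0 with hb₀_def
  have hb₀tr : Transcendental ℂ b₀ := transcendental_of_forall_ne (hb 0)
  have hprog3 : Submodule.span ℂ (Set.range fun i : Fin 3 => b₀ ^ (i : ℕ)) =
      K.map (LinearMap.mulLeft ℂ (f 0 * g 0)⁻¹) := by
    rw [hKj 0, dil_dil, inv_mul_cancel₀ (mul_ne_zero (hf 0) (hg 0)), dil_one]
  have h5 : ∀ j, ∃ h : L, h ≠ 0 ∧ h ∈ F j ∧ h * b₀ ∈ F j := fun j => by
    have hFne : F j ≠ ⊥ := by
      rw [Ne, ← Submodule.finrank_eq_zero, hF2 j]; omega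
    have h4 : finrank ℂ
        ↥(Submodule.span ℂ (Set.range fun i : Fin (1 + 2) => b₀ ^ (i : ℕ)) * F j) = 4 := by
      rw [show (1 + 2 : ℕ) = 3 from rfl, hprog3, ← dil_one (F j), dil_mul_dil, mul_one,
        finrank_dil (inv_ne_zero (mul_ne_zero (hf 0) (hg 0))), hKF j]
    have hbound : finrank ℂ
        ↥(Submodule.span ℂ (Set.range fun i : Fin (1 + 2) => b₀ ^ (i : ℕ)) * F j) ≤
          1 + 2 + finrank ℂ (F j) - 1 := by
      rw [h4, hF2 j]
    obtain ⟨h, hh0, hmem⟩ :=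
      exists_forall_mul_pow_mem_of_span_pow (hb 0) 1 (F j) inferInstance hFne hbound
    refine ⟨h, hh0, ?_, ?_⟩
    · simpa using hmem 0 (by rw [hF2 j]; omega)
    · simpa using hmem 1 (by rw [hF2 j]; omega)
  choose h hh0 hhF hhbF using h5
  -- `b₀ = l₁(a) / l₀(a)` in lowest terms
  obtain ⟨q, -, hq⟩ := exists_poly_of_mem_prog (hFle 0 (hhF 0))
  obtain ⟨p, -, hp⟩ := exists_poly_of_mem_prog (hFle 0 (hhbF 0))
  have hq0 : q ≠ 0 := by
    rintro rfl
    rw [map_zero] at hq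
    exact hh0 0 hq.symm
  set d : ℂ[X] := GCDMonoid.gcd p q with hd_def
  have hd0 : d ≠ 0 := gcd_ne_zero_of_right hq0
  set l₁ : ℂ[X] := p / d with hl₁_def
  set l₀ : ℂ[X] := q / d with hl₀_def
  have hcop : IsCoprime l₁ l₀ := isCoprime_div_gcd_div_gcd hq0
  have hdl₁ : d * l₁ = p := EuclideanDomain.mul_div_cancel' hd0 (gcd_dvd_left p q)
  have hdl₀ : d * l₀ = q := EuclideanDomain.mul_div_cancel' hd0 (gcd_dvd_right p q)
  have hl₀0 : l₀ ≠ 0 := right_div_gcd_ne_zero hq0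
  have hkey : aeval a l₀ * b₀ = aeval a l₁ := by
    have h1 : aeval a d * (aeval a l₀ * b₀) = aeval a d * aeval a l₁ := by
      rw [← mul_assoc, ← map_mul, hdl₀, hq, ← map_mul, hdl₁, hp]
    exact mul_left_cancel₀ (fun h0 => hd0 (hι (by rw [h0, map_zero]))) h1
  -- `F j = φ_j(a) · ⟨l₀(a), l₁(a)⟩`
  have hφ : ∀ j, ∃ φ : ℂ[X],
      φ ≠ 0 ∧ aeval a (φ * l₀) = h j ∧ aeval a (φ * l₁) = h j * b₀ := fun j => by
    obtain ⟨f₁, -, hf₁⟩ := exists_poly_of_mem_prog (hFle j (hhF j))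
    obtain ⟨f₂, -, hf₂⟩ := exists_poly_of_mem_prog (hFle j (hhbF j))
    have h1 : f₂ * l₀ = f₁ * l₁ := hι (by
      rw [map_mul, map_mul, hf₂, hf₁, mul_assoc, mul_comm b₀, hkey])
    obtain ⟨φ, hφ⟩ : l₀ ∣ f₁ :=
      hcop.symm.dvd_of_dvd_mul_right ⟨f₂, by rw [← h1, mul_comm]⟩
    refine ⟨φ, ?_, ?_, ?_⟩
    · rintro rfl
      rw [mul_zero] at hφ
      rw [hφ, map_zero] at hf₁
      exact hh0 j hf₁.symm
    · rw [mul_comm, ← hφ, hf₁]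
    · have h2 : f₂ = φ * l₁ := by
        apply mul_right_cancel₀ hl₀0
        rw [h1, hφ]; ring
      rw [← h2, hf₂]
  choose φ hφ0 hφ₀ hφ₁ using hφ
  obtain ⟨Ft, hFt_def⟩ : ∃ Ft : Fin 8 → Submodule ℂ ℂ[X],
      ∀ j, Ft j = Submodule.span ℂ {φ j * l₀, φ j * l₁} := ⟨_, fun j => rfl⟩
  have hFt : ∀ j, (Ft j).map (aeval a).toLinearMap = F j := fun j => by
    rw [hFt_def, Submodule.map_span, Set.image_pair, AlgHom.toLinearMap_apply,
      AlgHom.toLinearMap_apply, hφ₀, hφ₁]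
    apply le_antisymm
    · rw [Submodule.span_le]
      rintro _ (rfl | rfl)
      · exact hhF j
      · exact hhbF j
    · rw [← span_eq_of_forall_mul_pow_mem hb₀tr (hh0 j) (F j) (hF2 j) (fun i hi => by
        interval_cases i
        · simpa using hhF j
        · simpa using hhbF j)]
      refine Submodule.span_mono ?_
      rintro _ ⟨i, rfl⟩
      fin_cases i
      · simp
      · simp
  -- transfer of complementarity to `ℂ[X]`
  have hFtinf : ∀ j j', j ≠ j' → Ft j ⊓ Ft j' = ⊥ := fun j j' hjj' => by
    apply Submodule.map_injective_of_injective (f := (aeval a).toLinearMap) hι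
    rw [Submodule.map_inf _ hι, hFt, hFt, hFinf j j' hjj', Submodule.map_bot]
  have hone : ∀ j j', j ≠ j' → (1 : ℂ[X]) ∈ Ft j ⊔ Ft j' := fun j j' hjj' => by
    have h1 : (1 : L) ∈ (Ft j ⊔ Ft j').map (aeval a).toLinearMap := by
      rw [Submodule.map_sup, hFt, hFt, hFsup j j' hjj']
      exact Submodule.subset_span ⟨⟨0, by omega⟩, by simp⟩
    obtain ⟨x, hx, hx1⟩ := Submodule.mem_map.mp h1
    rw [AlgHom.toLinearMap_apply] at hx1
    have : x = 1 := hι (by rw [hx1, map_one])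
    rwa [this] at hx
  -- a non-zero `k ∈ K` is `k̃(a)` with `deg k̃ ≤ 6`, and every `φ j` divides `k̃`
  have hKne : K ≠ ⊥ := by
    rw [Ne, ← Submodule.finrank_eq_zero, hKfin]; omega
  obtain ⟨k, hkK, hk0⟩ := Submodule.exists_mem_ne_zero_of_ne_bot hKne
  have hK7 : K ≤ Submodule.span ℂ (Set.range fun i : Fin 7 => a ^ (i : ℕ)) :=
    calc K = F 0 * G 0 := by rw [hFGj 0, hKj 0]
      _ ≤ Submodule.span ℂ (Set.range fun i : Fin 4 => a ^ (i : ℕ)) *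
            Submodule.span ℂ (Set.range fun i : Fin 4 => a ^ (i : ℕ)) :=
          mul_le_mul' (hFle 0) (hGle 0)
      _ = Submodule.span ℂ (Set.range fun i : Fin 7 => a ^ (i : ℕ)) := prog_mul_prog a 3 3
  obtain ⟨kt, hktdeg, hkt⟩ := exists_poly_of_mem_prog (hK7 hkK)
  have hkt0 : kt ≠ 0 := by
    rintro rfl
    rw [map_zero] at hkt
    exact hk0 hkt.symm
  have hdvd : ∀ j, φ j ∣ kt := fun j => by
    have hall : ∀ z ∈ K, ∃ w : ℂ[X], aeval a (φ j * w) = z := by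
      intro z hz
      rw [hKj j, ← hFGj j] at hz
      refine Submodule.mul_induction_on hz ?_ ?_
      · intro m hm n hn
        rw [← hFt j, hFt_def] at hm
        obtain ⟨m', hm', rfl⟩ := Submodule.mem_map.mp hm
        obtain ⟨c₁, c₂, rfl⟩ := Submodule.mem_span_pair.mp hm'
        obtain ⟨n', -, rfl⟩ := exists_poly_of_mem_prog (hGle j hn)
        refine ⟨(c₁ • l₀ + c₂ • l₁) * n', ?_⟩
        rw [AlgHom.toLinearMap_apply, ← map_mul]
        congr 1
        simp only [smul_eq_C_mul]
        ring
      · rintro x y ⟨w₁, rfl⟩ ⟨w₂, rfl⟩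
        exact ⟨w₁ + w₂, by rw [mul_add, map_add]⟩
    obtain ⟨w, hw⟩ := hall k hkK
    exact ⟨w, hι (by rw [hkt, hw])⟩
  -- counting roots
  have hsep : ∀ j j' (r : ℂ), j ≠ j' → (φ j).IsRoot r → (φ j').IsRoot r → False := by
    intro j j' r hjj' hr hr'
    have hzero : ∀ w ∈ Ft j ⊔ Ft j', (w : ℂ[X]).eval r = 0 := by
      intro w hw
      obtain ⟨y, hy, z, hz, hyz⟩ := Submodule.mem_sup.mp hw
      rw [hFt_def j] at hy
      rw [hFt_def j'] at hz
      obtain ⟨c₁, c₂, hc⟩ := Submodule.mem_span_pair.mp hy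
      obtain ⟨d₁, d₂, hd⟩ := Submodule.mem_span_pair.mp hz
      rw [← hyz, ← hc, ← hd]
      simp only [eval_add, eval_smul, eval_mul, hr.eq_zero, hr'.eq_zero, zero_mul, smul_zero,
        add_zero]
    have := hzero 1 (hone j j' hjj')
    simp at this
  have hconst : ∀ j j', j ≠ j' → 0 < (φ j).degree ∨ 0 < (φ j').degree := by
    intro j j' hjj'
    by_contra hcon
    simp only [not_or, not_lt] at hcon
    have hmem : ∀ i, (φ i).degree ≤ 0 → l₀ ∈ Ft i := fun i hi => by
      set c : ℂ := (φ i).coeff 0 with hc_def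
      have hc : φ i = C c := eq_C_of_degree_le_zero hi
      have hc0 : c ≠ 0 := fun h0 => hφ0 i (by rw [hc, h0, C_0])
      have : l₀ = c⁻¹ • (φ i * l₀) := by
        rw [hc, smul_eq_C_mul, ← mul_assoc, ← C_mul, inv_mul_cancel₀ hc0, C_1, one_mul]
      rw [this, hFt_def]
      exact Submodule.smul_mem _ _ (Submodule.subset_span (Set.mem_insert _ _))
    have h0 : l₀ ∈ Ft j ⊓ Ft j' := Submodule.mem_inf.mpr ⟨hmem j hcon.1, hmem j' hcon.2⟩
    rw [hFtinf j j' hjj', Submodule.mem_bot] at h0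
    exact hl₀0 h0
  classical
  obtain ⟨J, hJ_def⟩ :
      ∃ J : Finset (Fin 8), J = Finset.univ.filter fun j => 0 < (φ j).degree := ⟨_, rfl⟩
  have hJc : (Finset.univ.filter fun j => ¬ 0 < (φ j).degree).card ≤ 1 := by
    rw [Finset.card_le_one]
    intro j hj j' hj'
    by_contra hjj'
    rw [Finset.mem_filter] at hj hj'
    rcases hconst j j' hjj' with h1 | h1
    · exact hj.2 h1
    · exact hj'.2 h1
  have hJ7 : 7 ≤ J.card := by
    have h1 := Finset.card_filter_add_card_filter_not (s := Finset.univ)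
      (fun j : Fin 8 => 0 < (φ j).degree)
    rw [← hJ_def] at h1
    simp only [Finset.card_univ, Fintype.card_fin] at h1
    omega
  have hroot : ∀ j, ∃ r : ℂ, 0 < (φ j).degree → (φ j).IsRoot r := fun j => by
    by_cases hj : 0 < (φ j).degree
    · obtain ⟨r, hr⟩ := Complex.exists_root hj
      exact ⟨r, fun _ => hr⟩
    · exact ⟨0, fun h' => absurd h' hj⟩
  choose r hr using hroot
  have hmaps : Set.MapsTo r ↑J ↑kt.roots.toFinset := fun j hj => by
    rw [Finset.mem_coe, hJ_def, Finset.mem_filter] at hj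
    rw [Finset.mem_coe, Multiset.mem_toFinset, mem_roots hkt0]
    exact eval_eq_zero_of_dvd_of_eval_eq_zero (hdvd j) (hr j hj.2)
  have hinj : Set.InjOn r ↑J := fun j hj j' hj' hrr => by
    rw [Finset.mem_coe, hJ_def, Finset.mem_filter] at hj hj'
    by_contra hjj'
    exact hsep j j' (r j) hjj' (hr j hj.2) (hrr ▸ hr j' hj'.2)
  have hcard := Finset.card_le_card_of_injOn r hmaps hinj
  have h6 : kt.roots.toFinset.card ≤ 6 := by
    refine (Multiset.toFinset_card_le _).trans ((card_roots' kt).trans ?_)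
    have : kt.natDegree < 7 := natDegree_lt_iff_degree_lt hkt0 |>.mpr hktdeg
    omega
  omega

end TwoByTwoHosting

end Summit.MatrixMultiplication.MatrixMultiplication.Theorems
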